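import Literature.AlgebraicGeometry.Resolution.PointBlowupIFPGiraudChain
import Mathlib.Algebra.CharP.Lemmas
import Mathlib.RingTheory.Adjoin.Polynomial.Basic
import Mathlib.LinearAlgebra.FiniteDimensional.Basic
import HarnessLib

/-!
# Kawanoue–Matsuki, corner model: `σ` equals its root value `(d, …, d, d − 1, d − 1, …)` EXACTLY at the corner
# nodes, lies strictly below it everywhere else, and therefore never increases — and drops exactly on leaving the
# corner — along an equimultiple edge out of a corner node (Prop. 4 (1) at corner parents)

`Literature/AlgebraicGeometry/Resolution/PointBlowupIFPSigmaCorner.lean` (cell `res-hironaka`, D-0124 rescue, literature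
seat `res-rescue-harvest-1` g6).  First theorems about the `σ`-layer typed in `PointBlowupIFPUnit.lean` §3
(`leadingAlgebra`, `purePiece`, `lPure`, `sigmaSeq`, `freshGenerators`, `sigmaFresh`, `sigmaCorner`, `IsCorner`),
which so far carried definitions only.

**Sources.** H. Kawanoue, *Toward resolution of singularities over a field of positive characteristic. Part I*,
Publ. RIMS **43** (2007) 819–909 = arXiv:math/0607009: Definition 3.1.1.1 (leading algebra `L(𝕀)`, its pure part
`L^{pure}_{p^e} = L_{p^e} ∩ F^e(G_1)`), Lemma 2.2.1.2 (2) (generators of the `𝔇`-saturation: `(∂_{X^J} f, a − |J|)`),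
Lemma 3.1.2.1 (the leading algebra of a `𝔇`-saturated filtration is generated by its pure part), Definition 3.2.1.1
[Kawanoue2007]; H. Kawanoue, K. Matsuki, *Part II*, Publ. RIMS **46** (2010) = arXiv:math/0612008, Definition 1.1.1.1
(`σ = (d − l^{pure}_{p^e})_{e ≥ 0}`) and Remark 1.1.1.2 [KawanoueMatsuki2010]; H. Kawanoue, K. Matsuki, Adv. Stud. Pure
Math. **70** (2016) = arXiv:1205.4556, §4.1 and Proposition 4 (1) («`σ` does not increase») [KawanoueMatsuki2016].

**What is proved (corner model `h = x^q + F(y)`, `q = p^e`, `K` a field of characteristic `p`, any finite number of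
residual variables).**  Write `T = freshGenerators q F` for the typed generating set `(x^q + F, q), (∂_J F, q − |J|)`
(`0 < |J| < q`) of the fresh `𝔇`-saturation at a node and `L = leadingAlgebra T = K[in g : (g, a) ∈ T exact]`.
* `eq_single_of_isCorner` (via `coeff_sub_hasseDeriv_single_self` of `AdditiveFormsStructure.lean`): at a CORNER node (`IsCorner q F`: no `∂_J F`, `0 < |J| < q`, has order exactly `q − |J|`)
  with `q ≤ ord₀ F`, every degree-`q` monomial of `F` is a pure power `y_i^q` — so the initial form of `h` is the
  Frobenius-pure form `x^q + Σ c_i y_i^q` (`initialForm_fresh_mem_frobeniusPureForms`).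
* `leadingAlgebra_freshGenerators_of_isCorner`: `L = K[in h]` — the derivative generators are all inexact.
* `purePiece_freshGenerators_of_lt` / `purePiece_freshGenerators_of_le`: `L^{pure}_{p^{e'}} = 0` for `p^{e'} < q` and
  `L^{pure}_{p^{e'}} = K · (in h)^{p^{e'−e}}` for `p^{e'} ≥ q`; hence `lPure = 0`, resp. `= 1`
  (`lPure_freshGenerators_of_lt` / `_of_le`).
* **`sigmaFresh_eq_sigmaCorner_of_isCorner`**: `σ = (d, …, d, d − 1, d − 1, …)` (`d` while `p^{e'} < q`, `d − 1` from
  `p^{e'} ≥ q` on), `d = #σ + 1` — the docstring claim of `IsCorner` / `sigmaCorner` in `PointBlowupIFPUnit.lean`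
  («the value of `σ` at every root of the atlas») as a theorem; and its chain forms
  `sigmaFresh_eq_sigmaCorner_along` (every corner node of a chain of point blow-ups at equimultiple points from a clean
  root carries the root value) and `not_sigmaDrops_not_sigmaIncreases_of_isCorner` (between two corner nodes of such a
  chain `σ` neither drops nor increases — the census columns `SigmaDrops` / `SigmaIncreases` read 0 there by theorem).
* §5, the other direction: `exists_lPure_pos_of_not_isCorner` — at a clean NON-corner node an exact derivative generator
  of MINIMAL level has an initial form killed by all intermediate Hasse–Schmidt derivatives
  (`hasseDeriv_initialForm_eq_zero_of_minimal`: the composition `∂_M ∂_J = c ∂_{M+J}` has `c = 0` in `K` or exhibits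
  an exact generator of smaller level), hence — by the structure theorem for such forms,
  `exists_eq_sum_C_mul_X_pow_of_hasseDeriv_eq_zero` of `AdditiveFormsStructure.lean` — is a PURE form
  `Σ c_i y_i^{p^{e'}}` of level `p^{e'} < q`: `l^{pure}_{p^j} ≥ 1` for all `j ≥ e'` (Frobenius).  This is the model form
  of the step «`L(𝕀)` is generated by its pure part» [Kawanoue2007, Lemma 3.1.2.1] that the comparison needs.  So
  `sigmaFresh_lt_sigmaCorner_of_not_isCorner` (`σ <_lex σ_corner` off the corner),
  **`sigmaFresh_eq_sigmaCorner_iff_isCorner`**, and at every equimultiple edge out of a clean corner node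
  **`sigmaDrops_iff_not_isCorner_step`** (`σ` DROPS iff the child leaves the corner, and `σ` never increases) and
  `sigmaLeavesCorner_iff_sigmaDrops` — [KawanoueMatsuki2016, Prop. 4 (1)] «`σ ≥ σ̃`» ‖ K[model] at corner parents, and
  the census's re-initialisation trigger `SigmaLeavesCorner` is a `σ`-drop by theorem.
NOT covered (and not claimed): Prop. 4 (1) at NON-corner parents (`σ` does not increase out of an arbitrary node — that
needs the transformation of a leading generator system, printed proof arXiv:1205.4556 p0022), perfectness of `K` (the
typed `frobeniusPureForms` is the span of the `x_i^{p^e}` by definition), positive-dimensional centres.  Every identification of the model's objects with the printed ones is OURS;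
nothing of Hironaka's 2017 manuscript is referred to or asserted.  Related and NOT restated here: the general theory (leading generator
systems, the pure part as a subspace, `dim L^{pure}_{p^e} ≤ dim W`, monotonicity in `e`) for idealistic filtrations over regular local
rings is `Literature/AlgebraicGeometry/Kawanoue2007/LeadingGeneratorSystemExists.lean` (`Kawanoue2007.exists_isLGS`, `lPure_le_*`,
`antitone_sigma`, …); the present file computes the explicit corner-model objects of `PointBlowupIFPUnit.lean` §3 only.

## References
* H. Kawanoue, Publ. RIMS 43 (2007) 819–909 = arXiv:math/0607009, Def. 3.1.1.1, Lemma 2.2.1.2, Lemma 3.1.2.1, Def. 3.2.1.1. [Kawanoue2007]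
* H. Kawanoue, K. Matsuki, Publ. RIMS 46 (2010) 359–422 = arXiv:math/0612008, Def. 1.1.1.1, Rem. 1.1.1.2. [KawanoueMatsuki2010]
* H. Kawanoue, K. Matsuki, Adv. Stud. Pure Math. 70 (2016) 115–214 = arXiv:1205.4556, §4.1, Prop. 4 (1). [KawanoueMatsuki2016]
* B. Schober, J. Algebra 565 (2021), Rem. 2.6 (structure of forms with vanishing intermediate Hasse–Schmidt derivatives; tree `AdditiveFormsStructure.lean`). [Schober2021IdealisticExponents]
-/

noncomputable section

open MvPolynomial Finset

open scoped BigOperators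

namespace Literature.AlgebraicGeometry.Resolution

open Literature.AlgebraicGeometry.Resolution.Hauser2010

open Literature.Barriers.ResolutionOfSingularities (ordZero_le_of_coeff_ne_zero le_ordZero_of_forall)

namespace PointBlowup

/-! ## 1. Two general facts: graded pieces of `K[w]` for a homogeneous `w`, and Frobenius powers of pure forms -/

section General

variable {ι : Type*} {K : Type*} [Field K]

/-- A homogeneous element of degree `n` of the algebra `K[w]` generated by ONE homogeneous form `w` of degree
`q ≥ 1` is a scalar multiple of `w^{n/q}`, and is `0` unless `q ∣ n` (graded pieces of a one-generator graded
subalgebra). [folklore] -/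
private theorem mem_span_pow_of_mem_adjoin {w y : MvPolynomial ι K} {q n : ℕ} (hq : 0 < q)
    (hw : w.IsHomogeneous q) (hy : y ∈ Algebra.adjoin K ({w} : Set (MvPolynomial ι K)))
    (hyn : y.IsHomogeneous n) : y ∈ K ∙ (w ^ (n / q)) ∧ (¬ q ∣ n → y = 0) := by
  rw [Algebra.adjoin_singleton_eq_range_aeval, AlgHom.mem_range] at hy
  obtain ⟨P, hP⟩ := hy
  have hsum : Polynomial.aeval w P = ∑ i ∈ range (P.natDegree + 1), P.coeff i • w ^ i :=
    Polynomial.aeval_eq_sum_range w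
  -- the degree-`n` component of `Σ aᵢ wⁱ` keeps only the term with `q i = n`
  have hcomp : homogeneousComponent n (Polynomial.aeval w P) =
      ∑ i ∈ range (P.natDegree + 1), if n = q * i then P.coeff i • w ^ i else 0 := by
    rw [hsum, map_sum]
    refine Finset.sum_congr rfl fun i _ => ?_
    rw [map_smul, homogeneousComponent_of_mem (hw.pow i)]
    split_ifs <;> simp
  have hself : homogeneousComponent n (Polynomial.aeval w P) = Polynomial.aeval w P :=
    homogeneousComponent_eq_self (hP ▸ hyn)
  rw [← hP]
  constructor
  · rw [← hself, hcomp]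
    refine Submodule.sum_mem _ fun i _ => ?_
    split_ifs with h
    · rw [h, Nat.mul_div_cancel_left _ hq]
      exact Submodule.smul_mem _ _ (Submodule.mem_span_singleton_self _)
    · exact Submodule.zero_mem _
  · intro hndvd
    rw [← hself, hcomp]
    refine Finset.sum_eq_zero fun i _ => ?_
    rw [if_neg]
    rintro rfl
    exact hndvd (dvd_mul_right q i)

/-- Frobenius on pure forms: if `x` lies in the `K`-span of the `y_i^n` then, in characteristic `p`, `x^{p^k}` lies in the
`K`-span of the `y_i^{n p^k}` (`(Σ cᵢ yᵢⁿ)^{p^k} = Σ cᵢ^{p^k} yᵢ^{n p^k}`). [folklore] -/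
private theorem pow_char_pow_mem_frobeniusPureForms (p : ℕ) [Fact p.Prime] [CharP K p] (n k : ℕ)
    {x : MvPolynomial ι K} (hx : x ∈ frobeniusPureForms ι K n) :
    x ^ p ^ k ∈ frobeniusPureForms ι K (n * p ^ k) := by
  unfold frobeniusPureForms at hx ⊢
  induction hx using Submodule.span_induction with
  | mem y hy =>
    obtain ⟨i, rfl⟩ := hy
    rw [← pow_mul]
    exact Submodule.subset_span ⟨i, rfl⟩
  | zero =>
    rw [zero_pow (pow_ne_zero _ (Nat.Prime.ne_zero Fact.out))]
    exact Submodule.zero_mem _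
  | add y z _ _ hy hz =>
    rw [add_pow_char_pow]
    exact Submodule.add_mem _ hy hz
  | smul c y _ hy =>
    rw [smul_pow]
    exact Submodule.smul_mem _ _ hy

/-- Pure forms are stable under the renaming `y_i ↦ y_{some i}` into one more variable. [folklore] -/
private theorem rename_some_mem_frobeniusPureForms (n : ℕ) {x : MvPolynomial ι K}
    (hx : x ∈ frobeniusPureForms ι K n) :
    rename some x ∈ frobeniusPureForms (Option ι) K n := by
  unfold frobeniusPureForms at hx ⊢
  induction hx using Submodule.span_induction with
  | mem y hy =>
    obtain ⟨i, rfl⟩ := hy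
    rw [map_pow, rename_X]
    exact Submodule.subset_span ⟨some i, rfl⟩
  | zero => rw [map_zero]; exact Submodule.zero_mem _
  | add y z _ _ hy hz => rw [map_add]; exact Submodule.add_mem _ hy hz
  | smul c y _ hy =>
    rw [MvPolynomial.smul_eq_C_mul, map_mul, rename_C, ← MvPolynomial.smul_eq_C_mul]
    exact Submodule.smul_mem _ _ hy

/-- Pure forms of exponent `n` are homogeneous of degree `n`. [folklore] -/
private theorem isHomogeneous_of_mem_frobeniusPureForms (n : ℕ) {x : MvPolynomial ι K}
    (hx : x ∈ frobeniusPureForms ι K n) : x.IsHomogeneous n := by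
  unfold frobeniusPureForms at hx
  induction hx using Submodule.span_induction with
  | mem y hy => obtain ⟨i, rfl⟩ := hy; exact isHomogeneous_X_pow i n
  | zero => exact isHomogeneous_zero _ _ _
  | add y z _ _ hy hz => exact hy.add hz
  | smul c y _ hy =>
    rw [MvPolynomial.smul_eq_C_mul]
    simpa using (isHomogeneous_C ι c).mul hy

/-- `ord₀` is invariant under the renaming `y_i ↦ y_{some i}`. [folklore] -/
private theorem ordZero_rename_some [DecidableEq ι] (G : MvPolynomial ι K) :
    ordZero (rename (some : ι → Option ι) G) = ordZero G := by
  rcases eq_or_ne G 0 with rfl | hG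
  · rw [map_zero, ordZero_zero, ordZero_zero]
  obtain ⟨o, ho⟩ := exists_ordZero_eq_natCast hG
  rw [ho]
  apply le_antisymm
  · -- a monomial of degree `o` of `G` survives the renaming
    have : homogeneousComponent o G ≠ 0 := homogeneousComponent_ne_zero_of_ordZero_eq ho
    obtain ⟨d, hd⟩ : ∃ d, coeff d (homogeneousComponent o G) ≠ 0 := by
      by_contra h
      push Not at h
      exact this (MvPolynomial.ext _ _ fun d => by rw [h d, coeff_zero])
    rw [coeff_homogeneousComponent] at hd
    split_ifs at hd with hdeg
    · have hc : coeff (Finsupp.mapDomain some d) (rename some G) ≠ 0 := by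
        rwa [coeff_rename_mapDomain _ (Option.some_injective ι)]
      calc ordZero (rename some G) ≤ ((Finsupp.mapDomain some d).degree : ℕ∞) :=
            ordZero_le_of_coeff_ne_zero _ _ hc
        _ = o := by rw [Finsupp.degree_mapDomain, hdeg]
    · exact absurd rfl hd
  · refine le_ordZero_of_forall _ _ fun d' hd' => ?_
    obtain ⟨d, rfl⟩ : ∃ d, Finsupp.mapDomain some d = d' := by
      by_contra h
      push Not at h
      exact hd' (coeff_rename_eq_zero _ _ _ fun d hdd => absurd hdd (h d))
    rw [coeff_rename_mapDomain _ (Option.some_injective ι)] at hd'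
    rw [Finsupp.degree_mapDomain]
    have := ordZero_le_of_coeff_ne_zero _ _ hd'
    rw [ho] at this
    exact_mod_cast this

end General

/-! ## 2. The corner shape: degree-`q` monomials of `F` are `q`-th powers; the initial form of `x^q + F` is pure -/

section CornerShape

variable {σ : Type*} {K : Type*} [Field K] [DecidableEq σ]

/-- **Corner shape.** At a corner node (`IsCorner q F`) with `q ≤ ord₀ F`, every monomial of degree `q` of `F` is a
pure `q`-th power `y_i^q`: otherwise some `0 < d_i < q` and `∂_{d_i e_i} F` has order exactly `q − d_i`, i.e. is an
EXACT generator of level `q − d_i`, against the corner hypothesis. [cite: Kawanoue2007, Definition 3.2.1.1 and Lemma 2.2.1.2 (2)] -/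
theorem eq_single_of_isCorner [Fintype σ] {q : ℕ} {F : MvPolynomial σ K} (hc : IsCorner q F)
    (hF : (q : ℕ∞) ≤ ordZero F) {d : σ →₀ ℕ} (hd : d ∈ F.support) (hdeg : d.degree = q) (hq : 0 < q) :
    ∃ i, d = Finsupp.single i q := by
  classical
  -- some exponent is positive
  have hd0 : d ≠ 0 := by
    rintro rfl
    rw [map_zero] at hdeg
    omega
  obtain ⟨i, hi⟩ : ∃ i, d i ≠ 0 := by
    by_contra h
    push Not at h
    exact hd0 (Finsupp.ext h)
  by_cases hdi : d i = q
  · -- then all the other exponents vanish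
    refine ⟨i, Finsupp.ext fun j => ?_⟩
    by_cases hj : j = i
    · subst hj; simp [hdi]
    · rw [Finsupp.single_eq_of_ne hj]
      have hle : Finsupp.single i (d i) ≤ d := by
        intro k
        by_cases hk : k = i
        · subst hk; simp
        · simp [Finsupp.single_eq_of_ne hk]
      have hsplit : d = Finsupp.single i (d i) + (d - Finsupp.single i (d i)) := (add_tsub_cancel_of_le hle).symm
      have hdeg' : (d - Finsupp.single i (d i)).degree = 0 := by
        have := congrArg Finsupp.degree hsplit
        rw [map_add, Finsupp.degree_single, hdeg] at this
        omega
      rw [Finsupp.degree_eq_zero_iff] at hdeg'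
      have := congrArg (fun f => f j) hdeg'
      simp only [Finsupp.coe_tsub, Pi.sub_apply, Finsupp.single_eq_of_ne hj, tsub_zero,
        Finsupp.coe_zero, Pi.zero_apply] at this
      exact this
  · -- otherwise `0 < d i < q` and `∂_{d_i e_i} F` is exact: contradiction
    exfalso
    have hdi_le : d i ≤ q := by
      rw [← hdeg]
      exact Finsupp.le_degree i d
    have hdi_lt : d i < q := lt_of_le_of_ne hdi_le hdi
    set J : σ →₀ ℕ := Finsupp.single i (d i) with hJ
    have hJdeg : J.degree = d i := Finsupp.degree_single _ _
    have hle : J ≤ d := by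
      intro k
      by_cases hk : k = i
      · subst hk; simp [hJ]
      · simp [hJ, Finsupp.single_eq_of_ne hk]
    have hsubdeg : (d - J).degree = q - d i := by
      have := congrArg Finsupp.degree (add_tsub_cancel_of_le hle)
      rw [map_add, hJdeg, hdeg] at this
      omega
    -- upper bound from the surviving coefficient
    have hcoeff : coeff (d - J) (hasseDeriv J F) ≠ 0 := by
      rw [hJ, hasseDeriv_eq_hasseDeriv, coeff_sub_hasseDeriv_single_self]
      exact mem_support_iff.mp hd
    have hup : ordZero (hasseDeriv J F) ≤ ((q - d i : ℕ) : ℕ∞) := by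
      have := ordZero_le_of_coeff_ne_zero _ _ hcoeff
      rwa [hsubdeg] at this
    -- lower bound from `q ≤ ord₀ F`
    have hlow : ((q - d i : ℕ) : ℕ∞) ≤ ordZero (hasseDeriv J F) := by
      have h1 := ordZero_sub_le_ordZero_hasseDeriv J F
      rw [hJdeg] at h1
      refine le_trans ?_ h1
      rw [ENat.coe_sub]
      exact tsub_le_tsub_right hF _
    exact hc J (by rw [hJdeg]; exact Nat.pos_of_ne_zero hi) (by rw [hJdeg]; exact hdi_lt)
      (by rw [hJdeg]; exact le_antisymm hup hlow)

/-- At a corner node with `q ≤ ord₀ F`, the degree-`q` homogeneous component of `F` is a pure form `Σ c_i y_i^q`.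
[cite: Kawanoue2007, Definition 3.1.1.1 (2) and Definition 3.2.1.1] -/
theorem homogeneousComponent_mem_frobeniusPureForms_of_isCorner [Fintype σ] {q : ℕ} {F : MvPolynomial σ K}
    (hc : IsCorner q F) (hF : (q : ℕ∞) ≤ ordZero F) (hq : 0 < q) :
    homogeneousComponent q F ∈ frobeniusPureForms σ K q := by
  classical
  rw [homogeneousComponent_apply]
  refine Submodule.sum_mem _ fun d hd => ?_
  rw [Finset.mem_filter] at hd
  obtain ⟨i, rfl⟩ := eq_single_of_isCorner hc hF hd.1 hd.2 hq
  rw [← C_mul_X_pow_eq_monomial, ← MvPolynomial.smul_eq_C_mul]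
  exact Submodule.smul_mem _ _ (Submodule.subset_span ⟨i, rfl⟩)

/-- The fresh head `h = x^q + F(y)` (`x = X none`) has order exactly `q` when `q ≤ ord₀ F`: `(h, q)` is an EXACT
generator. [cite: Kawanoue2007, Definition 3.1.1.1 (1)] -/
theorem ordZero_fresh_head {q : ℕ} (hq : 0 < q) {F : MvPolynomial σ K} (hF : (q : ℕ∞) ≤ ordZero F) :
    ordZero ((X none : MvPolynomial (Option σ) K) ^ q + rename some F) = q := by
  classical
  apply le_antisymm
  · -- the coefficient of `x^q` is `1`
    have hc : coeff (Finsupp.single none q) ((X none : MvPolynomial (Option σ) K) ^ q + rename some F) ≠ 0 := by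
      rw [coeff_add, coeff_X_pow, if_pos rfl, coeff_rename_eq_zero, add_zero]
      · exact one_ne_zero
      · intro d hd
        exfalso
        have h1 := DFunLike.congr_fun hd none
        rw [Finsupp.mapDomain_notin_range _ _ (by rintro ⟨x, hx⟩; exact Option.some_ne_none x hx),
          Finsupp.single_eq_same] at h1
        omega
    have := ordZero_le_of_coeff_ne_zero _ _ hc
    rwa [Finsupp.degree_single] at this
  · refine le_ordZero_add ?_ ?_
    · rw [ordZero_X_pow]
    · rw [ordZero_rename_some]; exact hF

/-- The initial form of the fresh head at a corner node is the pure form `x^q + (F)_q`, `(F)_q = Σ c_i y_i^q`; in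
particular it lies in `F^e(G_1)` = `frobeniusPureForms (Option σ) K q`. [cite: Kawanoue2007, Definition 3.1.1.1 (2) and Definition 3.2.1.1] -/
theorem initialForm_fresh_mem_frobeniusPureForms [Fintype σ] {q : ℕ} {F : MvPolynomial σ K}
    (hc : IsCorner q F) (hF : (q : ℕ∞) ≤ ordZero F) (hq : 0 < q) :
    HauserPerlega2019.initialForm ((X none : MvPolynomial (Option σ) K) ^ q + rename some F) ∈
      frobeniusPureForms (Option σ) K q := by
  classical
  unfold HauserPerlega2019.initialForm
  rw [ordZero_fresh_head hq hF, ENat.toNat_coe, map_add,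
    homogeneousComponent_eq_self (isHomogeneous_X_pow _ _), ← rename_homogeneousComponent]
  exact Submodule.add_mem _ (Submodule.subset_span ⟨none, rfl⟩)
    (rename_some_mem_frobeniusPureForms q (homogeneousComponent_mem_frobeniusPureForms_of_isCorner hc hF hq))

/-- The initial form of the fresh head is homogeneous of degree `q` and non-zero. [cite: Kawanoue2007, Definition 3.1.1.1 (1)] -/
theorem initialForm_fresh_isHomogeneous {q : ℕ} (hq : 0 < q) {F : MvPolynomial σ K} (hF : (q : ℕ∞) ≤ ordZero F) :
    (HauserPerlega2019.initialForm ((X none : MvPolynomial (Option σ) K) ^ q + rename some F)).IsHomogeneous q ∧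
      HauserPerlega2019.initialForm ((X none : MvPolynomial (Option σ) K) ^ q + rename some F) ≠ 0 := by
  classical
  unfold HauserPerlega2019.initialForm
  rw [ordZero_fresh_head hq hF, ENat.toNat_coe]
  exact ⟨homogeneousComponent_isHomogeneous _ _,
    homogeneousComponent_ne_zero_of_ordZero_eq (ordZero_fresh_head hq hF)⟩

end CornerShape

/-! ## 3. The leading algebra, its pure part and `σ` at a corner node -/

section Sigma

variable {σ : Type*} {K : Type*} [Field K] [DecidableEq σ] [DecidableEq K]

/-- At a corner node with `q ≤ ord₀ F` the only EXACT fresh generator is the head `(x^q + F, q)` — every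
`(∂_J F, q − |J|)`, `0 < |J| < q`, is inexact by the corner hypothesis — so the leading algebra is the one-generator
algebra `K[in(x^q + F)]`. [cite: Kawanoue2007, Definition 3.1.1.1 (1) and Definition 3.2.1.1] -/
theorem leadingAlgebra_freshGenerators_of_isCorner {q : ℕ} (hq : 0 < q) {F : MvPolynomial σ K}
    (hc : IsCorner q F) (hF : (q : ℕ∞) ≤ ordZero F) :
    leadingAlgebra (freshGenerators q F) =
      Algebra.adjoin K {HauserPerlega2019.initialForm ((X none : MvPolynomial (Option σ) K) ^ q + rename some F)} := by
  classical
  set h : MvPolynomial (Option σ) K := (X none : MvPolynomial (Option σ) K) ^ q + rename some F with hh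
  have hexact : IsExactGen (h, q) := by
    unfold IsExactGen
    exact ordZero_fresh_head hq hF
  -- every exact generator has initial form `in h`
  have hall : ∀ ga ∈ freshGenerators q F, IsExactGen ga → HauserPerlega2019.initialForm ga.1 = HauserPerlega2019.initialForm h := by
    intro ga hga hex
    unfold freshGenerators at hga
    rw [Finset.mem_insert] at hga
    rcases hga with rfl | hga
    · rfl
    · exfalso
      rw [Finset.mem_image] at hga
      obtain ⟨J, hJ, rfl⟩ := hga
      obtain ⟨hJ0, hJq⟩ := IFPState.degree_lt_of_mem_derivIndices hJ
      unfold IsExactGen at hex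
      simp only at hex
      rw [ordZero_rename_some] at hex
      exact hc J hJ0 hJq hex
  unfold leadingAlgebra
  apply le_antisymm
  · refine Algebra.adjoin_le ?_
    rintro w ⟨ga, hga, hex, rfl⟩
    rw [hall ga hga hex]
    exact Algebra.self_mem_adjoin_singleton K _
  · refine Algebra.adjoin_mono ?_
    rintro w hw
    rw [Set.mem_singleton_iff] at hw
    subst hw
    exact ⟨(h, q), by unfold freshGenerators; exact Finset.mem_insert_self _ _, hexact, rfl⟩

/-- Below the head level there are no pure leading forms at a corner node: `L^{pure}_{p^{e'}} = 0` for `p^{e'} < q`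
(indeed `L_n = 0` for `0 < n < q`). [cite: KawanoueMatsuki2010, Definition 1.1.1.1] -/
theorem purePiece_freshGenerators_of_lt {q : ℕ} {F : MvPolynomial σ K} (hc : IsCorner q F)
    (hF : (q : ℕ∞) ≤ ordZero F) (p e' : ℕ) (hp : 0 < p) (hlt : p ^ e' < q) :
    purePiece (freshGenerators q F) p e' = ⊥ := by
  classical
  have hq : 0 < q := lt_of_le_of_lt (Nat.zero_le _) hlt
  rw [Submodule.eq_bot_iff]
  intro y hy
  unfold purePiece leadingPiece at hy
  rw [leadingAlgebra_freshGenerators_of_isCorner hq hc hF] at hy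
  obtain ⟨⟨hyL, hyn⟩, -⟩ := Submodule.mem_inf.mp hy |>.imp_left Submodule.mem_inf.mp
  rw [Subalgebra.mem_toSubmodule] at hyL
  rw [mem_homogeneousSubmodule] at hyn
  exact (mem_span_pow_of_mem_adjoin hq (initialForm_fresh_isHomogeneous hq hF).1 hyL hyn).2
    (Nat.not_dvd_of_pos_of_lt (pow_pos hp _) hlt)

/-- From the head level on, the pure part at a corner node is the line spanned by the Frobenius power of the head's
initial form: `L^{pure}_{p^{e'}} = K · (x^q + Σ c_i y_i^q)^{p^{e'−e}}` for `q = p^e ≤ p^{e'}`.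
[cite: KawanoueMatsuki2010, Definition 1.1.1.1] [cite: Kawanoue2007, Definition 3.2.1.1] -/
theorem purePiece_freshGenerators_of_le [Fintype σ] (p : ℕ) [Fact p.Prime] [CharP K p] (e e' : ℕ) (hee' : e ≤ e')
    {F : MvPolynomial σ K} (hc : IsCorner (p ^ e) F) (hF : ((p ^ e : ℕ) : ℕ∞) ≤ ordZero F) :
    purePiece (freshGenerators (p ^ e) F) p e' =
      K ∙ (HauserPerlega2019.initialForm ((X none : MvPolynomial (Option σ) K) ^ p ^ e + rename some F)) ^ p ^ (e' - e) := by
  classical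
  set w := HauserPerlega2019.initialForm ((X none : MvPolynomial (Option σ) K) ^ p ^ e + rename some F) with hw
  have hq : 0 < p ^ e := pow_pos (Nat.Prime.pos Fact.out) _
  have hpow : p ^ e' = p ^ e * p ^ (e' - e) := by rw [← pow_add, Nat.add_sub_cancel' hee']
  obtain ⟨hwhom, -⟩ := initialForm_fresh_isHomogeneous (σ := σ) (K := K) hq hF
  apply le_antisymm
  · intro y hy
    unfold purePiece leadingPiece at hy
    rw [leadingAlgebra_freshGenerators_of_isCorner hq hc hF] at hy
    obtain ⟨⟨hyL, hyn⟩, -⟩ := Submodule.mem_inf.mp hy |>.imp_left Submodule.mem_inf.mp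
    rw [Subalgebra.mem_toSubmodule] at hyL
    rw [mem_homogeneousSubmodule] at hyn
    have := (mem_span_pow_of_mem_adjoin hq hwhom hyL hyn).1
    rwa [hpow, Nat.mul_div_cancel_left _ hq] at this
  · rw [Submodule.span_singleton_le_iff_mem]
    unfold purePiece leadingPiece
    refine Submodule.mem_inf.mpr ⟨Submodule.mem_inf.mpr ⟨?_, ?_⟩, ?_⟩
    · rw [Subalgebra.mem_toSubmodule, leadingAlgebra_freshGenerators_of_isCorner hq hc hF]
      exact Subalgebra.pow_mem _ (Algebra.self_mem_adjoin_singleton K _) _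
    · rw [mem_homogeneousSubmodule, hpow]
      exact hwhom.pow _
    · have hmem := pow_char_pow_mem_frobeniusPureForms (ι := Option σ) p (p ^ e) (e' - e)
        (initialForm_fresh_mem_frobeniusPureForms hc hF hq)
      rwa [← hpow] at hmem

/-- `l^{pure}_{p^{e'}} = 0` at a corner node for `p^{e'} < q`. [cite: KawanoueMatsuki2010, Definition 1.1.1.1] -/
theorem lPure_freshGenerators_of_lt {q : ℕ} {F : MvPolynomial σ K} (hc : IsCorner q F)
    (hF : (q : ℕ∞) ≤ ordZero F) (p e' : ℕ) (hp : 0 < p) (hlt : p ^ e' < q) :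
    lPure (freshGenerators q F) p e' = 0 := by
  unfold lPure
  rw [purePiece_freshGenerators_of_lt hc hF p e' hp hlt, finrank_bot]

/-- `l^{pure}_{p^{e'}} = 1` at a corner node for `q = p^e ≤ p^{e'}`. [cite: KawanoueMatsuki2010, Definition 1.1.1.1] [cite: Kawanoue2007, Definition 3.2.1.1] -/
theorem lPure_freshGenerators_of_le [Fintype σ] (p : ℕ) [Fact p.Prime] [CharP K p] (e e' : ℕ) (hee' : e ≤ e')
    {F : MvPolynomial σ K} (hc : IsCorner (p ^ e) F) (hF : ((p ^ e : ℕ) : ℕ∞) ≤ ordZero F) :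
    lPure (freshGenerators (p ^ e) F) p e' = 1 := by
  classical
  unfold lPure
  rw [purePiece_freshGenerators_of_le p e e' hee' hc hF]
  refine finrank_span_singleton (pow_ne_zero _ ?_)
  exact (initialForm_fresh_isHomogeneous (σ := σ) (K := K) (pow_pos (Nat.Prime.pos Fact.out) _) hF).2

/-- **`σ` at a corner node is the root value `(d, …, d, d − 1, d − 1, …)`** (`d` while `p^{e'} < q = p^e`, `d − 1` from
`p^{e'} ≥ q` on; `d = #σ + 1` = the number of variables `x, y_1, …, y_n`): the docstring claim of `IsCorner` /
`sigmaCorner` as a theorem, for `K` of characteristic `p` and `q ≤ ord₀ F`.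
[cite: Kawanoue2007, Definition 3.2.1.1] [cite: KawanoueMatsuki2010, Definition 1.1.1.1 and Remark 1.1.1.2] -/
theorem sigmaFresh_eq_sigmaCorner_of_isCorner [Fintype σ] (p : ℕ) [Fact p.Prime] [CharP K p] (e : ℕ)
    {F : MvPolynomial σ K} (hc : IsCorner (p ^ e) F) (hF : ((p ^ e : ℕ) : ℕ∞) ≤ ordZero F) :
    sigmaFresh p (p ^ e) F = sigmaCorner (Fintype.card σ + 1) p (p ^ e) := by
  classical
  funext e'
  unfold sigmaFresh sigmaSeq sigmaCorner
  rw [Fintype.card_option]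
  have hp : 1 < p := Nat.Prime.one_lt Fact.out
  split_ifs with hlt
  · rw [lPure_freshGenerators_of_lt hc hF p e' (Nat.Prime.pos Fact.out) hlt, Nat.sub_zero]
  · have hee' : e ≤ e' := (Nat.pow_le_pow_iff_right hp).mp (not_lt.mp hlt)
    rw [lPure_freshGenerators_of_le p e e' hee' hc hF]

end Sigma

/-! ## 4. Along chains of point blow-ups at equimultiple points -/

section Chain

variable {σ : Type*} {K : Type*} [Field K] [Fintype σ] [DecidableEq σ] [DecidableEq K]

/-- Along ANY sequence of point blow-ups of `x^q + F(y)` at equimultiple points from a clean root (`q = p^e ≤ ord₀ F`),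
every state is clean (`q ≤ ord₀ (s n).F`) — so every CORNER node of the chain carries the root value of `σ`.
[cite: KawanoueMatsuki2016, §4.1] [cite: Kawanoue2007, Definition 3.2.1.1] -/
theorem sigmaFresh_eq_sigmaCorner_along (p : ℕ) [Fact p.Prime] [CharP K p] (e : ℕ)
    (s : ℕ → State σ K) (j : ℕ → σ) (b : ℕ → σ → K)
    (hs : ∀ n, s (n + 1) = step (p ^ e) (j n) (b n) (s n))
    (hF : ((p ^ e : ℕ) : ℕ∞) ≤ ordZero (s 0).F)
    (hequi : ∀ n, IsEquimultiplePoint (p ^ e) (j n) (b n) (s n)) (n : ℕ) (hc : IsCorner (p ^ e) (s n).F) :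
    sigmaFresh p (p ^ e) (s n).F = sigmaCorner (Fintype.card σ + 1) p (p ^ e) := by
  have hclean : ∀ n, ((p ^ e : ℕ) : ℕ∞) ≤ ordZero (s n).F := by
    intro n
    induction n with
    | zero => exact hF
    | succ n _ =>
      rw [hs n]
      exact le_ordZero_step_of_isEquimultiplePoint (p ^ e) (j n) (b n) (s n) (hequi n)
  exact sigmaFresh_eq_sigmaCorner_of_isCorner p e hc (hclean n)

/-- Between two CORNER nodes of such a chain `σ` neither drops nor increases: the census columns `SigmaDrops` /
`SigmaIncreases` read 0 on corner-to-corner edges by theorem (Prop. 4 (1) «`σ ≥ σ̃`» at these edges, with equality).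
[cite: KawanoueMatsuki2016, Proposition 4 (1)] -/
theorem not_sigmaDrops_not_sigmaIncreases_of_isCorner (p : ℕ) [Fact p.Prime] [CharP K p] (e : ℕ)
    (j : σ) (b : σ → K) (s : State σ K) (hF : ((p ^ e : ℕ) : ℕ∞) ≤ ordZero s.F)
    (hequi : IsEquimultiplePoint (p ^ e) j b s) (hc : IsCorner (p ^ e) s.F)
    (hc' : IsCorner (p ^ e) (step (p ^ e) j b s).F) :
    ¬ SigmaDrops p (p ^ e) j b s ∧ ¬ SigmaIncreases p (p ^ e) j b s := by
  have hF' : ((p ^ e : ℕ) : ℕ∞) ≤ ordZero (step (p ^ e) j b s).F :=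
    le_ordZero_step_of_isEquimultiplePoint (p ^ e) j b s hequi
  have h1 := sigmaFresh_eq_sigmaCorner_of_isCorner p e hc hF
  have h2 := sigmaFresh_eq_sigmaCorner_of_isCorner p e hc' hF'
  unfold SigmaDrops SigmaIncreases SigmaLexLt
  rw [h1, h2]
  exact ⟨lt_irrefl _, lt_irrefl _⟩

end Chain

/-! ## 5. Out of the corner `σ` DROPS: Prop. 4 (1) at every edge whose parent is a corner node

At a clean NON-corner node some derivative generator `(∂_J F, q − |J|)` is exact; one of MINIMAL level `a₀ < q` has an
initial form `G` all of whose intermediate Hasse–Schmidt derivatives vanish (a non-vanishing one would exhibit an exact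
generator of smaller level — the composition `∂_M ∂_J = c · ∂_{M+J}` either has `c = 0` in `K`, and then `∂_M G = 0`
outright, or `c ≠ 0`, and then `∂_{M+J} F` is exact), so by the structure theorem for such forms
(`exists_eq_sum_C_mul_X_pow_of_hasseDeriv_eq_zero`, [Schober2021IdealisticExponents, Rem. 2.6]) `a₀ = p^{e'}` and
`G = Σ c_i y_i^{p^{e'}}` is a PURE leading form of level `p^{e'} < q`: `l^{pure}_{p^{e'}} ≥ 1`, and by Frobenius
`l^{pure}_{p^{j}} ≥ 1` for every `j ≥ e'`.  Hence `σ <_lex σ_corner` — this is the model form of the step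
«`L(𝕀)` is generated by its pure part» [Kawanoue2007, Lemma 3.1.2.1] that the comparison needs. -/

section Drop

variable {σ : Type*} {K : Type*} [Field K] [DecidableEq σ]

/-- Hasse–Schmidt derivatives commute with taking homogeneous components (orders `|M| ≤ n`):
`∂_M (P)_n = (∂_M P)_{n − |M|}`. [cite: EGAIV4, Thm. 16.11.2 (16.11.2.1)] -/
private theorem hasseDeriv_homogeneousComponent (M : σ →₀ ℕ) (n : ℕ) (hMn : M.degree ≤ n) (P : MvPolynomial σ K) :
    Resolution.hasseDeriv K M (homogeneousComponent n P) =
      homogeneousComponent (n - M.degree) (Resolution.hasseDeriv K M P) := by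
  classical
  ext β
  rw [coeff_hasseDeriv, coeff_homogeneousComponent, coeff_homogeneousComponent, coeff_hasseDeriv]
  have hdeg : (M + β).degree = n ↔ β.degree = n - M.degree := by rw [map_add]; omega
  by_cases h : β.degree = n - M.degree
  · rw [if_pos h, if_pos (hdeg.mpr h)]
  · rw [if_neg h, if_neg (fun h' => h (hdeg.mp h')), mul_zero]

/-- A non-zero Hasse derivative `∂_J F ≠ 0` has its index in the carried family: `J ∈ derivIndices q F` for
`0 < |J| < q`. [cite: Kawanoue2007, Lemma 2.2.1.2] -/
theorem mem_derivIndices_of_ne_zero [DecidableEq K] {q : ℕ} {F : MvPolynomial σ K} {J : σ →₀ ℕ}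
    (hJ0 : 0 < J.degree) (hJq : J.degree < q) (hne : hasseDeriv J F ≠ 0) : J ∈ IFPState.derivIndices q F := by
  classical
  unfold IFPState.derivIndices
  rw [Finset.mem_filter]
  refine ⟨?_, hJ0, hJq, hne⟩
  -- some monomial `d ≥ J` of `F`
  obtain ⟨β, hβ⟩ : ∃ β, coeff β (hasseDeriv J F) ≠ 0 := by
    by_contra h
    push Not at h
    exact hne (MvPolynomial.ext _ _ fun β => by rw [h β, coeff_zero])
  rw [hasseDeriv_eq_hasseDeriv, coeff_hasseDeriv] at hβ
  have hd : coeff (J + β) F ≠ 0 := fun h => hβ (by rw [h, mul_zero])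
  rw [Finset.mem_biUnion]
  exact ⟨J + β, mem_support_iff.mpr hd, Finset.mem_Iic.mpr le_self_add⟩

/-- **Minimal exact level ⇒ pure leading form.**  At a clean node (`q ≤ ord₀ F`) let `(∂_J F, a)` (`a = q − |J|`,
`0 < |J| < q`) be an EXACT derivative generator of MINIMAL level among the exact ones.  Then every Hasse–Schmidt
derivative `∂_M`, `0 < |M| < a`, kills the initial form of `∂_J F`. [cite: Kawanoue2007, Lemma 3.1.2.1] -/
theorem hasseDeriv_initialForm_eq_zero_of_minimal [Fintype σ] {q : ℕ} {F : MvPolynomial σ K}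
    (hF : (q : ℕ∞) ≤ ordZero F) {J : σ →₀ ℕ} (hJq : J.degree < q)
    (hex : ordZero (hasseDeriv J F) = ((q - J.degree : ℕ) : ℕ∞))
    (hmin : ∀ J' : σ →₀ ℕ, 0 < J'.degree → J'.degree < q →
      ordZero (hasseDeriv J' F) = ((q - J'.degree : ℕ) : ℕ∞) → q - J.degree ≤ q - J'.degree)
    {M : σ →₀ ℕ} (hM0 : M ≠ 0) (hMa : M.degree < q - J.degree) :
    Resolution.hasseDeriv K M (HauserPerlega2019.initialForm (hasseDeriv J F)) = 0 := by
  classical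
  set a := q - J.degree with ha
  have hMdeg : 0 < M.degree := by
    rw [pos_iff_ne_zero, Ne, Finsupp.degree_eq_zero_iff]; exact hM0
  -- the composition `∂_M ∂_J F = c • ∂_{J+M} F`
  have hcomp : Resolution.hasseDeriv K M (hasseDeriv J F) =
      ((∏ i ∈ (J + M).support, ((J + M) i).choose (J i) : ℕ) : MvPolynomial σ K) *
        Resolution.hasseDeriv K (J + M) F := by
    rw [hasseDeriv_eq_hasseDeriv, hasseDeriv_hasseDeriv]
  unfold HauserPerlega2019.initialForm
  rw [hex, ENat.toNat_coe, hasseDeriv_homogeneousComponent M a hMa.le]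
  -- it suffices that `∂_M ∂_J F` has order `> a − |M|`
  apply homogeneousComponent_eq_zero_of_lt_ordZero
  rw [hcomp]
  set c : ℕ := ∏ i ∈ (J + M).support, ((J + M) i).choose (J i) with hc
  by_cases hc0 : ((c : ℕ) : K) = 0
  · -- `c = 0` in `K`: the composition vanishes
    have : ((c : ℕ) : MvPolynomial σ K) = 0 := by rw [← map_natCast C, hc0, map_zero]
    rw [this, zero_mul, ordZero_zero]
    exact WithTop.coe_lt_top _
  · -- `c ≠ 0`: `∂_{J+M} F` would be exact of level `a − |M| < a`
    rw [← map_natCast C, ordZero_C_mul hc0]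
    have hJM0 : 0 < (J + M).degree := by rw [map_add]; omega
    have hJMq : (J + M).degree < q := by rw [map_add]; omega
    -- lower bound `q − |J+M| ≤ ord ∂_{J+M} F`
    have hlow : ((q - (J + M).degree : ℕ) : ℕ∞) ≤ ordZero (Resolution.hasseDeriv K (J + M) F) := by
      have h1 := ordZero_sub_le_ordZero_hasseDeriv (J + M) F
      rw [hasseDeriv_eq_hasseDeriv] at h1
      refine le_trans ?_ h1
      rw [ENat.coe_sub]
      exact tsub_le_tsub_right hF _
    have hval : q - (J + M).degree = a - M.degree := by rw [map_add]; omega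
    rcases hlow.lt_or_eq with hlt | heq
    · rwa [hval] at hlt
    · -- equality = exactness at a smaller level: contradicts minimality
      exfalso
      have hex' : ordZero (hasseDeriv (J + M) F) = ((q - (J + M).degree : ℕ) : ℕ∞) := by
        rw [hasseDeriv_eq_hasseDeriv]; exact heq.symm
      have := hmin (J + M) hJM0 hJMq hex'
      omega

/-- **At a clean NON-corner node there is a pure leading form of some level `p^{e'} < q`** (`q = p^e`, char `p`):
`rename some (in ∂_J F) = Σ c_i y_i^{p^{e'}} ≠ 0` lies in `L(T)^{pure}_{p^{e'}}`, so `l^{pure}_{p^{e'}} ≥ 1`; and by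
Frobenius `l^{pure}_{p^{j}} ≥ 1` for every `j ≥ e'`. [cite: Kawanoue2007, Lemma 3.1.2.1] [cite: KawanoueMatsuki2010, Definition 1.1.1.1] -/
theorem exists_lPure_pos_of_not_isCorner [Fintype σ] [DecidableEq K] (p : ℕ) [Fact p.Prime] [CharP K p] (e : ℕ)
    {F : MvPolynomial σ K} (hc : ¬ IsCorner (p ^ e) F) (hF : ((p ^ e : ℕ) : ℕ∞) ≤ ordZero F) :
    ∃ e' < e, ∀ j, e' ≤ j → 1 ≤ lPure (freshGenerators (p ^ e) F) p j := by
  classical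
  set q := p ^ e with hq
  have hp := (Fact.out : p.Prime)
  -- an exact derivative generator of minimal level
  have hexists : ∃ a, ∃ J : σ →₀ ℕ, 0 < J.degree ∧ J.degree < q ∧
      ordZero (hasseDeriv J F) = ((q - J.degree : ℕ) : ℕ∞) ∧ a = q - J.degree := by
    unfold IsCorner at hc
    push Not at hc
    obtain ⟨J, hJ0, hJq, hJ⟩ := hc
    exact ⟨q - J.degree, J, hJ0, hJq, hJ, rfl⟩
  obtain ⟨J, hJ0, hJq, hex, ha⟩ := Nat.find_spec hexists
  have hmin : ∀ J' : σ →₀ ℕ, 0 < J'.degree → J'.degree < q →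
      ordZero (hasseDeriv J' F) = ((q - J'.degree : ℕ) : ℕ∞) → q - J.degree ≤ q - J'.degree := by
    intro J' h0 hq' hex'
    rw [← ha]
    exact Nat.find_min' hexists ⟨J', h0, hq', hex', rfl⟩
  set a := q - J.degree with haJ
  have ha0 : 1 ≤ a := by omega
  have haq : a < q := by omega
  set g := hasseDeriv J F with hg
  set G := HauserPerlega2019.initialForm g with hG
  have hg0 : g ≠ 0 := ne_zero_of_ordZero_eq_natCast hex
  have hGhom : G.IsHomogeneous a := by
    rw [hG]; unfold HauserPerlega2019.initialForm; rw [hex, ENat.toNat_coe]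
    exact homogeneousComponent_isHomogeneous _ _
  have hG0 : G ≠ 0 := by
    rw [hG]; unfold HauserPerlega2019.initialForm; rw [hex, ENat.toNat_coe]
    exact homogeneousComponent_ne_zero_of_ordZero_eq hex
  have hD : ∀ A : σ →₀ ℕ, A ≠ 0 → A.degree < a → Resolution.hasseDeriv K A G = 0 :=
    fun A hA0 hAa => hasseDeriv_initialForm_eq_zero_of_minimal hF hJq hex hmin hA0 hAa
  -- structure theorem: `a = p^{e'}`, `G = Σ c_i y_i^{p^{e'}}`
  obtain ⟨e', c, hae', hGsum⟩ := exists_eq_sum_C_mul_X_pow_of_hasseDeriv_eq_zero p hGhom ha0 hG0 hD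
  have he'e : e' < e := (Nat.pow_lt_pow_iff_right hp.one_lt).mp (by rw [← hae', ← hq]; exact haq)
  refine ⟨e', he'e, fun j hj => ?_⟩
  -- the pure form `rename some G ^ p^{j-e'}` of level `p^j`
  have hGpure : rename some G ∈ frobeniusPureForms (Option σ) K (p ^ e') := by
    apply rename_some_mem_frobeniusPureForms
    rw [hGsum]
    refine Submodule.sum_mem _ fun i _ => ?_
    rw [← MvPolynomial.smul_eq_C_mul]
    exact Submodule.smul_mem _ _ (Submodule.subset_span ⟨i, rfl⟩)
  have hpow : p ^ j = p ^ e' * p ^ (j - e') := by rw [← pow_add, Nat.add_sub_cancel' hj]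
  set w := rename some G ^ p ^ (j - e') with hw
  have hw0 : w ≠ 0 := pow_ne_zero _ (by
    rw [Ne, ← map_zero (rename (some : σ → Option σ)), (rename_injective _ (Option.some_injective σ)).eq_iff]
    exact hG0)
  -- `(rename some g, a)` is an exact fresh generator with initial form `rename some G`
  have hmemT : (rename some g, q - J.degree) ∈ freshGenerators q F := by
    unfold freshGenerators
    refine Finset.mem_insert_of_mem (Finset.mem_image.mpr ⟨J, ?_, rfl⟩)
    exact mem_derivIndices_of_ne_zero hJ0 hJq hg0
  have hexT : IsExactGen (rename some g, q - J.degree) := by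
    unfold IsExactGen; simp only; rw [ordZero_rename_some]; exact hex
  have hinT : HauserPerlega2019.initialForm (rename some g) = rename some G := by
    rw [hG]; unfold HauserPerlega2019.initialForm
    rw [ordZero_rename_some, hex, ENat.toNat_coe, rename_homogeneousComponent]
  have hGgen : rename some G ∈ {w : MvPolynomial (Option σ) K |
      ∃ ga ∈ freshGenerators q F, IsExactGen ga ∧ w = HauserPerlega2019.initialForm ga.1} :=
    ⟨(rename some g, q - J.degree), hmemT, hexT, hinT.symm⟩
  have hwL : w ∈ leadingAlgebra (freshGenerators q F) := by
    unfold leadingAlgebra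
    exact Subalgebra.pow_mem _ (Algebra.subset_adjoin hGgen) _
  have hwP : w ∈ purePiece (freshGenerators q F) p j := by
    unfold purePiece leadingPiece
    refine Submodule.mem_inf.mpr ⟨Submodule.mem_inf.mpr ⟨?_, ?_⟩, ?_⟩
    · rwa [Subalgebra.mem_toSubmodule]
    · rw [mem_homogeneousSubmodule, hpow, hw]
      exact (isHomogeneous_of_mem_frobeniusPureForms _ hGpure).pow _
    · rw [hpow, hw]
      exact pow_char_pow_mem_frobeniusPureForms p (p ^ e') (j - e') hGpure
  -- finrank ≥ 1
  haveI : FiniteDimensional K (frobeniusPureForms (Option σ) K (p ^ j)) :=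
    FiniteDimensional.span_of_finite K (Set.finite_range _)
  haveI : FiniteDimensional K (purePiece (freshGenerators q F) p j) :=
    Submodule.finiteDimensional_of_le (by unfold purePiece; exact inf_le_right)
  unfold lPure
  calc 1 = Module.finrank K (K ∙ w) := (finrank_span_singleton hw0).symm
    _ ≤ Module.finrank K (purePiece (freshGenerators q F) p j) :=
        Submodule.finrank_mono ((Submodule.span_singleton_le_iff_mem _ _).mpr hwP)

/-- **`σ` at a clean non-corner node lies STRICTLY (lexicographically) below the root value.**
[cite: KawanoueMatsuki2016, Proposition 4 (1)] [cite: Kawanoue2007, Lemma 3.1.2.1 and Definition 3.2.1.1] -/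
theorem sigmaFresh_lt_sigmaCorner_of_not_isCorner [Fintype σ] [DecidableEq K] (p : ℕ) [Fact p.Prime] [CharP K p]
    (e : ℕ) {F : MvPolynomial σ K} (hc : ¬ IsCorner (p ^ e) F) (hF : ((p ^ e : ℕ) : ℕ∞) ≤ ordZero F) :
    SigmaLexLt (sigmaFresh p (p ^ e) F) (sigmaCorner (Fintype.card σ + 1) p (p ^ e)) := by
  classical
  obtain ⟨e', he'e, hl⟩ := exists_lPure_pos_of_not_isCorner p e hc hF
  have hp := (Fact.out : p.Prime)
  unfold SigmaLexLt
  apply Pi.toLex_strictMono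
  refine lt_of_le_of_ne (fun j => ?_) (fun h => ?_)
  · -- pointwise `σ ≤ σ_corner`
    simp only [sigmaFresh, sigmaSeq, sigmaCorner, Fintype.card_option]
    split_ifs with hlt
    · exact Nat.sub_le _ _
    · have hej : e ≤ j := (Nat.pow_le_pow_iff_right hp.one_lt).mp (not_lt.mp hlt)
      have h1 : 1 ≤ lPure (freshGenerators (p ^ e) F) p j := hl j (le_of_lt (lt_of_lt_of_le he'e hej))
      omega
  · -- strict at `j = e'` (`p^{e'} < q`, `l^{pure} ≥ 1`)
    have h1 := congrFun h e'
    simp only [sigmaFresh, sigmaSeq, sigmaCorner, Fintype.card_option,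
      if_pos ((Nat.pow_lt_pow_iff_right hp.one_lt).mpr he'e)] at h1
    have h2 : 1 ≤ lPure (freshGenerators (p ^ e) F) p e' := hl e' le_rfl
    have h3 := lPure_le_card (freshGenerators (p ^ e) F) p e'
    rw [Fintype.card_option] at h3
    omega

/-- **`σ ≤_lex σ_corner` at every clean node, with equality iff the node is a corner.**
[cite: KawanoueMatsuki2016, Proposition 4 (1)] [cite: Kawanoue2007, Definition 3.2.1.1] -/
theorem sigmaFresh_eq_sigmaCorner_iff_isCorner [Fintype σ] [DecidableEq K] (p : ℕ) [Fact p.Prime] [CharP K p]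
    (e : ℕ) {F : MvPolynomial σ K} (hF : ((p ^ e : ℕ) : ℕ∞) ≤ ordZero F) :
    sigmaFresh p (p ^ e) F = sigmaCorner (Fintype.card σ + 1) p (p ^ e) ↔ IsCorner (p ^ e) F := by
  refine ⟨fun h => ?_, fun hc => sigmaFresh_eq_sigmaCorner_of_isCorner p e hc hF⟩
  by_contra hc
  have hlt := sigmaFresh_lt_sigmaCorner_of_not_isCorner p e hc hF
  unfold SigmaLexLt at hlt
  rw [h] at hlt
  exact lt_irrefl _ hlt

/-- **Kawanoue–Matsuki Prop. 4 (1), corner model, at every equimultiple edge out of a CORNER node**: `σ` does not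
increase, and it DROPS exactly when the child leaves the corner (`SigmaLeavesCorner ↔ SigmaDrops`) — the census's
re-initialisation trigger is a `σ`-drop ‖ K[model]. [cite: KawanoueMatsuki2016, Proposition 4 (1) and §4.1 (Case: σ strictly less)] -/
theorem sigmaDrops_iff_not_isCorner_step [Fintype σ] [DecidableEq K] (p : ℕ) [Fact p.Prime] [CharP K p] (e : ℕ)
    (j : σ) (b : σ → K) (s : State σ K) (hF : ((p ^ e : ℕ) : ℕ∞) ≤ ordZero s.F)
    (hequi : IsEquimultiplePoint (p ^ e) j b s) (hc : IsCorner (p ^ e) s.F) :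
    (SigmaDrops p (p ^ e) j b s ↔ ¬ IsCorner (p ^ e) (step (p ^ e) j b s).F) ∧
      ¬ SigmaIncreases p (p ^ e) j b s := by
  have hF' : ((p ^ e : ℕ) : ℕ∞) ≤ ordZero (step (p ^ e) j b s).F :=
    le_ordZero_step_of_isEquimultiplePoint (p ^ e) j b s hequi
  have h1 := sigmaFresh_eq_sigmaCorner_of_isCorner p e hc hF
  refine ⟨⟨fun hdrop hc' => ?_, fun hc' => ?_⟩, fun hinc => ?_⟩
  · have h2 := sigmaFresh_eq_sigmaCorner_of_isCorner p e hc' hF'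
    unfold SigmaDrops SigmaLexLt at hdrop
    rw [h1, h2] at hdrop
    exact lt_irrefl _ hdrop
  · unfold SigmaDrops
    rw [h1]
    exact sigmaFresh_lt_sigmaCorner_of_not_isCorner p e hc' hF'
  · unfold SigmaIncreases SigmaLexLt at hinc
    rw [h1] at hinc
    by_cases hc' : IsCorner (p ^ e) (step (p ^ e) j b s).F
    · rw [sigmaFresh_eq_sigmaCorner_of_isCorner p e hc' hF'] at hinc
      exact lt_irrefl _ hinc
    · have hlt := sigmaFresh_lt_sigmaCorner_of_not_isCorner p e hc' hF'
      unfold SigmaLexLt at hlt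
      exact lt_asymm hinc hlt

/-- `SigmaLeavesCorner ↔ SigmaDrops` at an equimultiple edge out of a clean corner node.
[cite: KawanoueMatsuki2016, §4.1 (Case: the value of σ is strictly less)] -/
theorem sigmaLeavesCorner_iff_sigmaDrops [Fintype σ] [DecidableEq K] (p : ℕ) [Fact p.Prime] [CharP K p] (e : ℕ)
    (j : σ) (b : σ → K) (s : State σ K) (hF : ((p ^ e : ℕ) : ℕ∞) ≤ ordZero s.F)
    (hequi : IsEquimultiplePoint (p ^ e) j b s) (hc : IsCorner (p ^ e) s.F) :
    SigmaLeavesCorner (p ^ e) j b s ↔ SigmaDrops p (p ^ e) j b s := by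
  unfold SigmaLeavesCorner
  rw [(sigmaDrops_iff_not_isCorner_step p e j b s hF hequi hc).1]
  exact ⟨fun h => h.2, fun h => ⟨hc, h⟩⟩

end Drop

end PointBlowup

end Literature.AlgebraicGeometry.Resolution
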